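/-
Copyright (c) 2026 the pub-hodgecm-mathlib formalisation cell (harness21).  Prover seat hodgecm-mathlib-K2Liu-p26 (g2): Track B «K2-LIT»,
#184♮ = hLiu418 = stmt-HodgeConjecture-24832; #42S organ S1, (G) organ ROW (ρ-mid), step (M2a-C3): THE LEVI ROW OF THE TENSOR DATUM'S MIDDLE CELL —
★ (C2b′) `K2LiuTensorMiddleCellHaarDelta` ∘ ★ `swSectionTensorLoc_mul_right` ∘ ★ (C3-a) `K2LiuBlockImplementerLeviAction` (LEAD F0P6-plan (g14) BATCH #64 (1),
K2Liu-p08 (g5) desk 22:01:56Z shape (i)(ii); (M2a) chain lead K2Liu-p01 (g10)).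
-/
import Summits.HodgeConjecture.HodgeConjecture.Theorems.K2LiuTensorMiddleCellHaarDelta     -- ★ (C2b′) `exists_ne_zero_swSectionTensorLoc_flip_mul_nElem_eq_integral_frameMp`
import Summits.HodgeConjecture.HodgeConjecture.Theorems.K2LiuBlockImplementerLeviAction    -- ★ (C3-a) `toOp_localOmega_toOp_symm_eq_smul_leviOpPi`
import Summits.HodgeConjecture.HodgeConjecture.Theorems.K2LiuLocalSWTensorAdaptedBlocks     -- ★ F5c-A `isSiegelDelta_tensorEmbLoc`
import HarnessLib

/-!
# Crux `HLiu418`, #42S organ S1, (G) organ ROW (ρ-mid), step (M2a-C3): THE LEVI ROW OF THE TENSOR DATUM'S MIDDLE CELL —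
# `F_Ψ(w₁ · n(t) · k) = c · χ_v(det_Δ(k ⊗ 1)) · |det B|^{-1/2} · ∫_{X₁} ψ_v(−½⟨y, c_{t′} y⟩) (Γ′Ψ)(B⁻¹ · PD · y) dy`, `y = x₁ ⊔ 0`

Cell `hodgecm-mathlib`, crux item hLiu418 = `stmt-HodgeConjecture-24832`, route of record `HCCMUnconditional`; squad K2 ∕ K2Liu, road `K2_Liu`, socket #42S (a),
organ S1; LEAD F0P6-plan (g14) BATCH #64 (1) («(C3) Levi-row factorisation → K2Liu-p26 (g2) by lineage»), (M2a) chain lead K2Liu-p01 (g10), desk shape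
K2Liu-p08 (g5) 22:01:56Z (i) arbitrary `Ψ` at the implementer `Γ′ = op(frameMp_{PD} j̃(p₁,p₂))`, (ii) Siegel elements on the right.  THEOREMS ONLY (no `def`,
no `instance`, no `notation`, no named-fact hypothesis, no `sorry`); lane `--supports stmt-HodgeConjecture-24832` (count-neutral helper).

WHY.  Both S1 faces of record wait on the (ρ-mid) MIDDLE ROWS `hfac : ∀ x ∈ P_Δ, F_Φ(w₁·x) = K·g(x)` (inert ★ `K2LiuLocalSWSpanningInertOfPackages` `hfac±`,
split ★ `K2LiuLocalSWSpanningSplitOfMoverMiddleRowsGeneral` `hmid`, ramified ★ `K2LiuLocalSWSpanningRamifiedOfMpMoverMiddleRow` via ★ p861891 + ★ p862370).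
★ (C2b′) `K2LiuTensorMiddleCellHaarDelta.exists_ne_zero_swSectionTensorLoc_flip_mul_nElem_eq_integral_frameMp` computes the middle cell on the UNIPOTENT
RADICAL: `F_Ψ(w₁ · n(t)) = c · ∫_{X₁} ψ_v(−½⟨y, c_{t′} y⟩) · (Γ′Ψ)(PD · y) dy` (`y = x₁ ⊔ 0`, ONE `c ≠ 0` for all `t`, `Ψ`).  A general `x ∈ P_Δ = N_Δ ⋊ M_Δ` is
`n(t) · k`; THIS FILE moves the right factor `k` through the section and the implementer:
* §1 (generic CM datum, any finite `v`, any `n`, `T₀`; ★ (C3-a) read on `ω(s_v p)` itself) **`toOp_toRep_localSplitting_eq_smul_leviOpPi`**: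
  `op(m) (ω(s_v p) Ψ) = χ_v(det_Δ p) • leviOpPi B (op(m) Ψ)` whenever `π(m) ι(p) π(m)⁻¹ = m(B)` (the transported-Levi letter `hB` BY VALUE), and its pointwise
  form **`coe_toOp_toRep_localSplitting_apply`**: `(op(m) (ω(s_v p) Ψ))(z) = χ_v(det_Δ p) · |det B|^{-1/2} · (op(m) Ψ)(B⁻¹ z)` (★ `coe_leviOpPi_apply`).
* §2 (the TENSOR datum, ★ (C2b′)'s letters VERBATIM) **`exists_ne_zero_swSectionTensorLoc_flip_mul_nElem_mul_eq_integral_levi`**: ONE `c ≠ 0` with, for every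
  skew `t` (and block-side `tb` framed by `P`), every `Ψ`, every `k ∈ P_Δ(U(𝕍□)_v)` and every `B` with
  `hB : π(frameMp_{PD} j̃)·ι′(k ⊗ 1)·π(frameMp_{PD} j̃)⁻¹ = transportSp 𝕋′ (m(B))`,
  `F_Ψ(w₁ · (n(t) · k)) = c · χ_v(det_Δ(k ⊗ 1)) · |det B|^{-1/2} · ∫_{X₁} ψ_v(−½⟨y, c_{t′} y⟩) · (Γ′Ψ)(B⁻¹ · PD · y) dμ^{⊗(M₂+M₂)}`
  (★ `swSectionTensorLoc_mul_right`: `F_Ψ(h · k) = F_{ω(s(k ⊗ 1))Ψ}(h)`; ★ (C2b′) at `ω(s(k ⊗ 1))Ψ`; §1 under the integral; the phase and `c_{t′}` are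
  (C2b′)'s, untouched by the Levi).
NOT here (next bricks of the chain): the discharge `∃ B, hB` for `k ∈ M_Δ` from the Cayley data of the implementer of record ((C2c), K2Liu-p01), the frame
reading `κ(B⁻¹ · PD · (y ⊔ 0))` (★ (C3-κ) `K2LiuWitnessCoordinateLeviRow.kappa_levi_rows` at `(k⁻¹, B⁻¹)` + the block reading of `PD · (y ⊔ 0)`), and the
evaluation ★ (M2a-L)ϖ `K2LiuWitnessLeviReadingUniformizer` + ★ (M2b) `K2LiuMiddleProfileFactorisation` ⇒ `hfac`.
References: [Kudla1994] §3 Thm. 3.1; [HarrisKudlaSweet1996] §1 (1.11), (1.15)–(1.16); [Rangarao1993] Lemma 3.2 (3.8); [MoeglinVignerasWaldspurger1987] Chap. 2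
II.1 (A), II.2, II.6.
HONEST LABEL.  Count-neutral helper; it retires nothing by itself: `HC_CM` is proved only modulo the 7 printed citations (2 remaining named inputs:
hLiu418 = `stmt-HodgeConjecture-24832`, h413 = `stmt-HodgeConjecture-24833`) until rung 0 closes.

## References
* [Kudla1994] S. S. Kudla, *Splitting metaplectic covers of dual reductive pairs*, Israel J. Math. 87 (1994), §3 Thm. 3.1.
* [HarrisKudlaSweet1996] M. Harris, S. Kudla, W. J. Sweet, J. Amer. Math. Soc. 9 (1996), §1 (1.11), (1.15)–(1.16).
* [Rangarao1993] R. Ranga Rao, Pacific J. Math. 157 (1993), Lemma 3.2 (3.8).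
* [MoeglinVignerasWaldspurger1987] C. Mœglin, M.-F. Vignéras, J.-L. Waldspurger, LNM 1291 (1987), Chap. 2 II.
-/

set_option autoImplicit false
set_option linter.dupNamespace false -- the mandated namespace repeats `HodgeConjecture.HodgeConjecture`

noncomputable section

open scoped Matrix Kronecker
open NumberField IsDedekindDomain MeasureTheory Matrix
open Literature.RepresentationTheory.HeisenbergGroup Literature.RepresentationTheory.HeisenbergGroup.SymplecticMatrix
open Literature.NumberTheory.Automorphic Literature.NumberTheory.Automorphic.UnitaryGroup Literature.NumberTheory.Weil1964
open Literature.NumberTheory.GaloisRepresentations Literature.NumberTheory.GaloisRepresentations.IsNonarchimedeanLocalField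
open Literature.RepresentationTheory.HarrisKudlaSweet1996
open Literature.NumberTheory.GelbartRogawski1991 Literature.NumberTheory.GelbartRogawski1991.GRConstruction
open Literature.NumberTheory.GelbartRogawski1991.AdaptedBlocks
open Literature.NumberTheory.GelbartRogawski1991.UnitaryDualPair
open Literature.NumberTheory.GelbartRogawski1991.UnitaryDualPair.LocalSplitting
open Literature.NumberTheory.GelbartRogawski1991.UnitaryDualPair.LocalSplitting.FrameTransport
open Literature.NumberTheory.GelbartRogawski1991.UnitaryDualPair.LocalSplitting.DoubledBlock
open Literature.NumberTheory.K2Lit.SiegelDoubled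
open Summit.HodgeConjecture.HodgeConjecture.Cruxes.HLiu418.K2LiuLocalSWSectionDefs
open Summit.HodgeConjecture.HodgeConjecture.Cruxes.HLiu418.K2LiuLocalSWTensorAdaptedBlocks
open Summit.HodgeConjecture.HodgeConjecture.Cruxes.HLiu418.K2LiuLocalSWTensorBlockTransport
open Summit.HodgeConjecture.HodgeConjecture.Cruxes.HLiu418.K2LiuLocalSWTensorBlockFrame
open Summit.HodgeConjecture.HodgeConjecture.Cruxes.HLiu418.K2LiuLocalSWTensorBigCellLetters
open Summit.HodgeConjecture.HodgeConjecture.Cruxes.HLiu418.K2LiuLocalSWTensorMiddleCellTransport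
open Summit.HodgeConjecture.HodgeConjecture.Cruxes.HLiu418.K2LiuTensorMiddleCellHaarDelta
open Summit.HodgeConjecture.HodgeConjecture.Cruxes.HLiu418.K2LiuBlockImplementerLeviAction

namespace Summit.HodgeConjecture.HodgeConjecture.Cruxes.HLiu418.K2LiuTensorMiddleCellLeviRow

/-! ## §1 The local Weil action of a Siegel element read through an implementer (generic CM datum) -/

section Generic

variable (L : Type) [Field L] [NumberField L] [IsCMField L] (v : HeightOneSpectrum (𝓞 (Fp L)))
  [MeasurableSpace (v.adicCompletion (Fp L))] [BorelSpace (v.adicCompletion (Fp L))]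
  (μ : Measure (v.adicCompletion (Fp L))) [μ.IsAddHaarMeasure]
  (n : ℕ) {T₀ : Matrix (Fin n) (Fin n) (Fp L)} (hT₀ : T₀.IsSymm) (hT₀d : IsUnit T₀.det)
  {JD : Matrix (Fin (n + n)) (Fin (n + n)) L} (hJD : JD = (gramD (Fp L) n T₀).map (algebraMap (Fp L) L))
  (χ : HeckeCharacter L) (hχ : IsSplittingChar L 1 χ)

/-- `ω_v(p) Φ = toRep (s_v p) Φ` for the CM datum — `localOmega := toRep ∘ localSplitting` (★ `LocalSplittingDatum.localOmega`), by `rfl`.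
[cite: MoeglinVignerasWaldspurger1987, Chap. 2 II.1] -/
theorem localOmega_apply_eq_toRep_localSplitting (p : UnitaryGroup.localPi L (IsCMField.complexConj L) (n + n) JD v)
    (Φ : SchwartzBruhat (Fin (n + n) → v.adicCompletion (Fp L))) :
    (localSplittingDatumCM L v μ n hT₀ hT₀d hJD χ hχ).localOmega p Φ =
      MpPsi.toRep (localSchrodinger (Fp L) (n + n) (gramD (Fp L) n T₀) v)
        ((localSplittingDatumCM L v μ n hT₀ hT₀d hJD χ hχ).localSplitting p) Φ :=
  rfl

set_option maxHeartbeats 800000 in -- MEASURED: the default 200000 times out at `isDefEq` in the `rw` (the `MpPsi (localSchrodinger …)` carrier)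
/-- **`op(m) (ω(s_v p) Ψ) = χ_v(det_Δ p) • leviOpPi B (op(m) Ψ)`** — ★ (C3-a) `toOp_localOmega_toOp_symm_eq_smul_leviOpPi` read on `ω(s_v p) Ψ` itself
(`ω_v = toRep ∘ s_v` definitionally), for the CM local splitting datum at any finite place, any `m ∈ S̃p_ψ(𝕎^𝔻_v)`, `p ∈ P_Δ(F_v)` and `B` with
`π(m) ι(p) π(m)⁻¹ = m(B)`. [cite: Kudla1994, §3 Thm. 3.1] [cite: HarrisKudlaSweet1996, §1 (1.15)–(1.16)] [cite: MoeglinVignerasWaldspurger1987, Chap. 2 II.1 (A), II.6] -/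
theorem toOp_toRep_localSplitting_eq_smul_leviOpPi
    (m : LocalMp (Fp L) (n + n) (gramD (Fp L) n T₀) v)
    (p : UnitaryGroup.localPi L (IsCMField.complexConj L) (n + n) JD v)
    (hp : IsSiegelDelta (Fp L) L (IsCMField.complexConj L) (complexConj_imagUnit L) (imagUnit_ne_zero L)
      (imagUnit_mul_self L) v n hT₀ hJD p)
    (B : GL (Fin (n + n)) (v.adicCompletion (Fp L)))
    (hB : MpPsi.proj _ m * iotaD (Fp L) L (IsCMField.complexConj L) (complexConj_imagUnit L) (imagUnit_ne_zero L)
        (imagUnit_mul_self L) v n hT₀ hJD p * (MpPsi.proj _ m)⁻¹ =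
      transportSp (localGram (Fp L) (n + n) (gramD (Fp L) n T₀) v) (isUnit_det_localGram_gramD (Fp L) v n hT₀d) (levi B))
    (Ψ : SchwartzBruhat (Fin (n + n) → v.adicCompletion (Fp L))) :
    MpPsi.toOp _ m (MpPsi.toRep (localSchrodinger (Fp L) (n + n) (gramD (Fp L) n T₀) v)
        ((localSplittingDatumCM L v μ n hT₀ hT₀d hJD χ hχ).localSplitting p) Ψ) =
      ((chiDet (Fp L) L (IsCMField.complexConj L) v n
          (fun w' : PlacesOver L v => (χ.localComponent w'.1)⁻¹) p)⁻¹ : ℂˣ) • leviOpPi (glEquiv B) (MpPsi.toOp _ m Ψ) := by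
  -- `toRep (s_v p) = ω_v(p)` (definitional: `localOmega = toRep ∘ localSplitting`)
  rw [← localOmega_apply_eq_toRep_localSplitting L v μ n hT₀ hT₀d hJD χ hχ p Ψ]
  have h := toOp_localOmega_toOp_symm_eq_smul_leviOpPi L v μ n hT₀ hT₀d hJD χ hχ m p hp B hB (MpPsi.toOp _ m Ψ)
  simpa only [LinearEquiv.symm_apply_apply] using h

set_option maxHeartbeats 400000 in
/-- **pointwise: `(op(m) (ω(s_v p) Ψ))(z) = χ_v(det_Δ p) · |det B|^{-1/2} · (op(m) Ψ)(B⁻¹ z)`** (§1 + ★ `coe_leviOpPi_apply`).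
[cite: Rangarao1993, Lemma 3.2 (3.8), p. 351] [cite: Kudla1994, §3 Thm. 3.1] -/
theorem coe_toOp_toRep_localSplitting_apply
    (m : LocalMp (Fp L) (n + n) (gramD (Fp L) n T₀) v)
    (p : UnitaryGroup.localPi L (IsCMField.complexConj L) (n + n) JD v)
    (hp : IsSiegelDelta (Fp L) L (IsCMField.complexConj L) (complexConj_imagUnit L) (imagUnit_ne_zero L)
      (imagUnit_mul_self L) v n hT₀ hJD p)
    (B : GL (Fin (n + n)) (v.adicCompletion (Fp L)))
    (hB : MpPsi.proj _ m * iotaD (Fp L) L (IsCMField.complexConj L) (complexConj_imagUnit L) (imagUnit_ne_zero L)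
        (imagUnit_mul_self L) v n hT₀ hJD p * (MpPsi.proj _ m)⁻¹ =
      transportSp (localGram (Fp L) (n + n) (gramD (Fp L) n T₀) v) (isUnit_det_localGram_gramD (Fp L) v n hT₀d) (levi B))
    (Ψ : SchwartzBruhat (Fin (n + n) → v.adicCompletion (Fp L))) (z : Fin (n + n) → v.adicCompletion (Fp L)) :
    ((MpPsi.toOp _ m (MpPsi.toRep (localSchrodinger (Fp L) (n + n) (gramD (Fp L) n T₀) v)
        ((localSplittingDatumCM L v μ n hT₀ hT₀d hJD χ hχ).localSplitting p) Ψ) :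
        SchwartzBruhat (Fin (n + n) → v.adicCompletion (Fp L))) : (Fin (n + n) → v.adicCompletion (Fp L)) → ℂ) z =
      (((chiDet (Fp L) L (IsCMField.complexConj L) v n
          (fun w' : PlacesOver L v => (χ.localComponent w'.1)⁻¹) p)⁻¹ : ℂˣ) : ℂ) *
        (((modSqrt (glEquiv B) : ℂ))⁻¹ *
          ((MpPsi.toOp _ m Ψ : SchwartzBruhat (Fin (n + n) → v.adicCompletion (Fp L))) : (Fin (n + n) → v.adicCompletion (Fp L)) → ℂ)
            (((B⁻¹ : GL (Fin (n + n)) (v.adicCompletion (Fp L))) : Matrix (Fin (n + n)) (Fin (n + n)) (v.adicCompletion (Fp L))) *ᵥ z)) := by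
  rw [toOp_toRep_localSplitting_eq_smul_leviOpPi L v μ n hT₀ hT₀d hJD χ hχ m p hp B hB Ψ]
  simp only [Units.smul_def, Submodule.coe_smul, Pi.smul_apply, smul_eq_mul, coe_leviOpPi_apply, glEquiv_symm_apply]

end Generic

/-! ## §2 The tensor datum `𝕍 ⊗ V′`: the Levi row of the middle cell -/

section Tensor

variable (L : Type) [Field L] [NumberField L] [IsCMField L]
variable {N M : ℕ} (e : Fin N × Fin M ≃ Fin 2)
  (dV : Fin N → L) (hdV : ∀ i, IsCMField.complexConj L (dV i) = dV i)
  (dW : Fin M → L) (hdW : ∀ i, IsCMField.complexConj L (dW i) = dW i)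
variable {M₂ M' : ℕ} (eW : Fin M × Fin M₂ ≃ Fin M') (e' : Fin N × Fin M' ≃ Fin (M₂ + M₂))
  (dV' : Fin M₂ → L) (hdV' : ∀ k, IsCMField.complexConj L (dV' k) = dV' k)
  (v : HeightOneSpectrum (𝓞 (Fp L)))
  [MeasurableSpace (v.adicCompletion (Fp L))] [BorelSpace (v.adicCompletion (Fp L))]
  (μ : Measure (v.adicCompletion (Fp L))) [μ.IsAddHaarMeasure]
  (χ : HeckeCharacter L) (hχ : IsSplittingChar L 1 χ)

set_option maxHeartbeats 4000000 in -- MEASURED: 1600000 times out at `whnf` (the (C2b′) instance at `obtain` ∕ `Eq.trans`), as ★ (C2b′) itself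
/-- **(M2a-C3) THE LEVI ROW OF THE TENSOR DATUM'S MIDDLE CELL.**  Same data as ★ (C2b′) `exists_ne_zero_swSectionTensorLoc_flip_mul_nElem_eq_integral_frameMp`
(frame `σ, P, PD = P ⊕ P`, `Pᵀ·gramR(𝕍⊗V′)·P = T₁ ⊕ᶠ T₂ = diagonal t′`, flip `w₁` of line `i₀`, block data `T₁ = diagonal t₁`, Cayley-type `p₁` (`hW₁`), mover `p₂`,
conductor exponent `m` of `ψ_v`, ANY outer mover-implementer `m₀`); there is ONE `c ≠ 0` with, for every skew `t`, every block-side skew `tb` with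
`P_v tb P_v⁻¹ = reindex epsV (t ⊗ₖ 1)`, every `Ψ`, every Siegel element `k ∈ P_Δ(U(𝕍□)_v)` and every `B` carrying the transported-Levi letter
`π(frameMp_{PD} j̃(p₁,p₂)) · ι′(k ⊗ 1) · π(frameMp_{PD} j̃(p₁,p₂))⁻¹ = transportSp 𝕋′ (m(B))`:
`F_Ψ(w₁ · (n(t) · k)) = c · χ_v(det_Δ(k ⊗ 1)) · |det B|^{-1/2} · ∫_{X₁} ψ_v(−½⟨y, c_{tb} y⟩) · (Γ′Ψ)(B⁻¹ · PD · y) dμ^{⊗(M₂+M₂)}`, `y = x₁ ⊔ 0`,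
`Γ′ = op(frameMp_{PD} j̃(p₁,p₂))`, `χ_v(det_Δ q) = (∏_w χ_w⁻¹(det_Δ q_w))⁻¹`.
[cite: Kudla1994, §3 Thm. 3.1] [cite: HarrisKudlaSweet1996, §1 (1.11), (1.15)–(1.16)] [cite: Rangarao1993, Lemma 3.2 (3.8), p. 351]
[cite: MoeglinVignerasWaldspurger1987, Chap. 2 II.1 (A), II.2, II.6] -/
theorem exists_ne_zero_swSectionTensorLoc_flip_mul_nElem_mul_eq_integral_levi (hM₂ : 0 < M₂ + M₂)
    (hT₀d : IsUnit (gramR L e' dV hdV (tensorFrame L dW eW dV') (tensorFrame_real L dW hdW eW dV' hdV')).det)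
    {i₀ i₁ : Fin 2} (hi : i₀ ≠ i₁) {σ : Equiv.Perm (Fin (M₂ + M₂))}
    (hσ₀ : ∀ k, σ (epsV e eW e' (i₀, k)) = finSumFinEquiv (Sum.inl k)) (hσ₁ : ∀ k, σ (epsV e eW e' (i₁, k)) = finSumFinEquiv (Sum.inr k))
    {T₁ T₂ : Matrix (Fin M₂) (Fin M₂) (Fp L)}
    (P : GL (Fin (M₂ + M₂)) (Fp L)) (hPσ : (P : Matrix (Fin (M₂ + M₂)) (Fin (M₂ + M₂)) (Fp L)) = σ.toPEquiv.toMatrix)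
    (hP : ((P : Matrix (Fin (M₂ + M₂)) (Fin (M₂ + M₂)) (Fp L)))ᵀ *
        gramR L e' dV hdV (tensorFrame L dW eW dV') (tensorFrame_real L dW hdW eW dV' hdV') * (P : Matrix _ _ (Fp L)) =
      UnitaryGroup.finSum M₂ M₂ T₁ T₂)
    (t' : Fin (M₂ + M₂) → Fp L) (hT' : UnitaryGroup.finSum M₂ M₂ T₁ T₂ = Matrix.diagonal t') (hT₀'d : IsUnit (UnitaryGroup.finSum M₂ M₂ T₁ T₂).det)
    {PD : GL (Fin ((M₂ + M₂) + (M₂ + M₂))) (Fp L)} (hPD : PD = UnitaryGroup.reindexGL (e₂ (M₂ + M₂)) (UnitaryGroup.blockDiagGL (P, P)))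
    (m₀ : LocalMp (Fp L) ((M₂ + M₂) + (M₂ + M₂))
      (gramD (Fp L) (M₂ + M₂) (gramR L e' dV hdV (tensorFrame L dW eW dV') (tensorFrame_real L dW hdW eW dV' hdV'))) v)
    (hm₀ : (deltaLagrangian (Fp L) v (M₂ + M₂)).map (toLin (Fp L) v (MpPsi.proj _ m₀)) = lagrangianY (Fp L) ((M₂ + M₂) + (M₂ + M₂)) v)
    {w₁ : UnitaryGroup.localPi L (IsCMField.complexConj L) (2 + 2) (hermD L e dV hdV dW hdW) v}
    (hw₁ : adapt (matA (Fp L) L (IsCMField.complexConj L) v 2 w₁) =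
      Matrix.fromBlocks (1 - Matrix.single i₀ i₀ 1) (Matrix.single i₀ i₀ 1) (Matrix.single i₀ i₀ 1) (1 - Matrix.single i₀ i₀ 1))
    -- the block data of (M2a-C1)
    (hM₂' : 0 < M₂) (t₁ : Fin M₂ → Fp L) (hT₁t : T₁ = Matrix.diagonal t₁) (hT₁ : T₁.IsSymm) (hT₂ : T₂.IsSymm)
    (hT₁d : IsUnit T₁.det) (hT₂d : IsUnit T₂.det)
    (hTv₁ : IsUnit (localGram (Fp L) (M₂ + M₂) (gramD (Fp L) M₂ T₁) v).det)
    (p₁ : LocalMp (Fp L) (M₂ + M₂) (gramD (Fp L) M₂ T₁) v)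
    (hp₁ : (deltaLagrangian (Fp L) v M₂).map (toLin (Fp L) v (MpPsi.proj _ p₁)) = lagrangianY (Fp L) (M₂ + M₂) v)
    (B₁ : GL (Fin (M₂ + M₂)) (v.adicCompletion (Fp L)))
    (hW₁ : MpPsi.proj _ p₁ * iotaD (Fp L) L (IsCMField.complexConj L) (complexConj_imagUnit L) (imagUnit_ne_zero L)
        (imagUnit_mul_self L) v M₂ hT₁ rfl (weylDelta (Fp L) L (IsCMField.complexConj L) v M₂ (T₀ := T₁) rfl) * (MpPsi.proj _ p₁)⁻¹ =
      (transportSp (localGram (Fp L) (M₂ + M₂) (gramD (Fp L) M₂ T₁) v) hTv₁ (SymplecticGroup.symJ _ _))⁻¹ *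
        transportSp (localGram (Fp L) (M₂ + M₂) (gramD (Fp L) M₂ T₁) v) hTv₁ (levi B₁))
    {m : ℤ} (hm : (adeleAddCharAt (Fp L) v).HasConductorExp m)
    (p₂ : LocalMp (Fp L) (M₂ + M₂) (gramD (Fp L) M₂ T₂) v)
    (hp₂ : (deltaLagrangian (Fp L) v M₂).map (toLin (Fp L) v (MpPsi.proj _ p₂)) = lagrangianY (Fp L) (M₂ + M₂) v) :
    ∃ c : ℂ, c ≠ 0 ∧ ∀ (t : Matrix (Fin 2) (Fin 2) (LocalRing L v))
      (ht : (t.map (conjLocal L (IsCMField.complexConj L) v))ᵀ * gramS (Fp L) L v 2 (gramR L e dV hdV dW hdW) + gramS (Fp L) L v 2 (gramR L e dV hdV dW hdW) * t = 0)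
      (tb : Matrix (Fin (M₂ + M₂)) (Fin (M₂ + M₂)) (LocalRing L v))
      (htb : (tb.map (conjLocal L (IsCMField.complexConj L) v))ᵀ * gramS (Fp L) L v (M₂ + M₂) (UnitaryGroup.finSum M₂ M₂ T₁ T₂) +
        gramS (Fp L) L v (M₂ + M₂) (UnitaryGroup.finSum M₂ M₂ T₁ T₂) * tb = 0)
      (_hPX : (P : Matrix (Fin (M₂ + M₂)) (Fin (M₂ + M₂)) (Fp L)).map ((UnitaryGroup.toLocalRing L v).comp (algebraMap (Fp L) (v.adicCompletion (Fp L)))) * tb *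
        ((P⁻¹ : GL (Fin (M₂ + M₂)) (Fp L)) : Matrix (Fin (M₂ + M₂)) (Fin (M₂ + M₂)) (Fp L)).map
          ((UnitaryGroup.toLocalRing L v).comp (algebraMap (Fp L) (v.adicCompletion (Fp L)))) =
        Matrix.reindex (epsV e eW e') (epsV e eW e') (t ⊗ₖ (1 : Matrix (Fin M₂) (Fin M₂) (LocalRing L v))))
      (Ψ : SchwartzBruhat (Fin ((M₂ + M₂) + (M₂ + M₂)) → v.adicCompletion (Fp L)))
      (k : UnitaryGroup.localPi L (IsCMField.complexConj L) (2 + 2) (hermD L e dV hdV dW hdW) v)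
      (_hk : IsSiegelDelta (Fp L) L (IsCMField.complexConj L) (complexConj_imagUnit L) (imagUnit_ne_zero L) (imagUnit_mul_self L) v 2
        (gramR_isSymm L e dV hdV dW hdW) (hermD_eq_map_gramD L e dV hdV dW hdW) k)
      (B : GL (Fin ((M₂ + M₂) + (M₂ + M₂))) (v.adicCompletion (Fp L)))
      (_hB : MpPsi.proj _ (frameMp (Fp L) v ((M₂ + M₂) + (M₂ + M₂)) PD (transpose_pd_mul_gramD_mul_pd (Fp L) (M₂ + M₂) P hP hPD)
            (boxLoc (Fp L) v M₂ M₂ (T₁ := T₁) (T₂ := T₂) (p₁, p₂))) *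
          iotaD (Fp L) L (IsCMField.complexConj L) (complexConj_imagUnit L) (imagUnit_ne_zero L) (imagUnit_mul_self L) v (M₂ + M₂)
            (gramR_isSymm L e' dV hdV (tensorFrame L dW eW dV') (tensorFrame_real L dW hdW eW dV' hdV'))
            (hermD_eq_map_gramD L e' dV hdV (tensorFrame L dW eW dV') (tensorFrame_real L dW hdW eW dV' hdV'))
            (tensorEmbLoc L e dV hdV dW hdW eW e' dV' hdV' v k) *
          (MpPsi.proj _ (frameMp (Fp L) v ((M₂ + M₂) + (M₂ + M₂)) PD (transpose_pd_mul_gramD_mul_pd (Fp L) (M₂ + M₂) P hP hPD)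
            (boxLoc (Fp L) v M₂ M₂ (T₁ := T₁) (T₂ := T₂) (p₁, p₂))))⁻¹ =
        transportSp (localGram (Fp L) ((M₂ + M₂) + (M₂ + M₂))
            (gramD (Fp L) (M₂ + M₂) (gramR L e' dV hdV (tensorFrame L dW eW dV') (tensorFrame_real L dW hdW eW dV' hdV'))) v)
          (isUnit_det_localGram_gramD (Fp L) v (M₂ + M₂) hT₀d) (levi B)),
      swSectionTensorLoc L e dV hdV dW hdW eW e' dV' hdV' v
          (localSplittingDatumCM L v μ (M₂ + M₂)
            (gramR_isSymm L e' dV hdV (tensorFrame L dW eW dV') (tensorFrame_real L dW hdW eW dV' hdV')) hT₀d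
            (hermD_eq_map_gramD L e' dV hdV (tensorFrame L dW eW dV') (tensorFrame_real L dW hdW eW dV' hdV')) χ hχ).localSplitting
          m₀ Ψ
          (w₁ * (nElem (Fp L) L (IsCMField.complexConj L) v 2 (T₀ := gramR L e dV hdV dW hdW) (hermD_eq_map_gramD L e dV hdV dW hdW) t ht * k)) =
        c * ((((chiDet (Fp L) L (IsCMField.complexConj L) v (M₂ + M₂)
                (fun w' : PlacesOver L v => (χ.localComponent w'.1)⁻¹) (tensorEmbLoc L e dV hdV dW hdW eW e' dV' hdV' v k))⁻¹ : ℂˣ) : ℂ) *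
          (((modSqrt (glEquiv B) : ℂ))⁻¹ *
            ∫ x₁ : Fin (M₂ + M₂) → v.adicCompletion (Fp L),
              (adeleAddCharAt (Fp L) v
                  (-halfForm (Matrix.mulVecLin (cOfFix (localGram (Fp L) ((M₂ + M₂) + (M₂ + M₂)) (gramD (Fp L) (M₂ + M₂) (UnitaryGroup.finSum M₂ M₂ T₁ T₂)) v)
                    (MpPsi.proj _ (boxLoc (Fp L) v M₂ M₂ (T₁ := T₁) (T₂ := T₂) (p₁, p₂)) *
                      iotaD (Fp L) L (IsCMField.complexConj L) (complexConj_imagUnit L) (imagUnit_ne_zero L) (imagUnit_mul_self L) v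
                        (M₂ + M₂) (UnitaryGroup.isSymm_finSum hT₁ hT₂) rfl
                        (nElem (Fp L) L (IsCMField.complexConj L) v (M₂ + M₂) (T₀ := UnitaryGroup.finSum M₂ M₂ T₁ T₂) rfl tb htb) *
                      (MpPsi.proj _ (boxLoc (Fp L) v M₂ M₂ (T₁ := T₁) (T₂ := T₂) (p₁, p₂)))⁻¹)))
                    (glue (blkIdx M₂ M₂) x₁ (0 : Fin (M₂ + M₂) → v.adicCompletion (Fp L)))) : ℂ) *
                (((MpPsi.toOp _ (frameMp (Fp L) v ((M₂ + M₂) + (M₂ + M₂)) PD (transpose_pd_mul_gramD_mul_pd (Fp L) (M₂ + M₂) P hP hPD)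
                      (boxLoc (Fp L) v M₂ M₂ (T₁ := T₁) (T₂ := T₂) (p₁, p₂))) Ψ :
                    SchwartzBruhat (Fin ((M₂ + M₂) + (M₂ + M₂)) → v.adicCompletion (Fp L))) :
                  (Fin ((M₂ + M₂) + (M₂ + M₂)) → v.adicCompletion (Fp L)) → ℂ)
                  (((B⁻¹ : GL (Fin ((M₂ + M₂) + (M₂ + M₂))) (v.adicCompletion (Fp L))) :
                      Matrix (Fin ((M₂ + M₂) + (M₂ + M₂))) (Fin ((M₂ + M₂) + (M₂ + M₂))) (v.adicCompletion (Fp L))) *ᵥ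
                    frameLin (Fp L) v ((M₂ + M₂) + (M₂ + M₂)) PD (glue (blkIdx M₂ M₂) x₁ (0 : Fin (M₂ + M₂) → v.adicCompletion (Fp L)))))
              ∂(Measure.pi fun _ => μ))) := by
  obtain ⟨c, hc, h⟩ := exists_ne_zero_swSectionTensorLoc_flip_mul_nElem_eq_integral_frameMp L e dV hdV dW hdW eW e' dV' hdV' v μ χ hχ hM₂ hT₀d hi
    hσ₀ hσ₁ P hPσ hP t' hT' hT₀'d hPD m₀ hm₀ hw₁ hM₂' t₁ hT₁t hT₁ hT₂ hT₁d hT₂d hTv₁ p₁ hp₁ B₁ hW₁ hm p₂ hp₂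
  refine ⟨c, hc, fun t ht tb htb hPX Ψ k hk B hB => ?_⟩
  -- `F_Ψ(w₁ · (n(t) · k)) = F_{ω(s(k ⊗ 1))Ψ}(w₁ · n(t))` (★ right-translation law), then ★ (C2b′) at `ω(s(k ⊗ 1))Ψ`
  rw [← mul_assoc w₁, swSectionTensorLoc_mul_right]
  refine (h t ht tb htb hPX _).trans (congrArg (fun z => c * z) ?_)
  -- §1 under the integral: `(Γ′ (ω(s(k⊗1))Ψ))(PD·y) = χ_v(det_Δ(k⊗1)) · |det B|^{-1/2} · (Γ′Ψ)(B⁻¹·PD·y)`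
  rw [← integral_const_mul (L := ℂ), ← integral_const_mul (L := ℂ)]
  refine integral_congr_ae (Filter.Eventually.of_forall fun x₁ => ?_)
  dsimp only
  rw [coe_toOp_toRep_localSplitting_apply L v μ (M₂ + M₂)
    (gramR_isSymm L e' dV hdV (tensorFrame L dW eW dV') (tensorFrame_real L dW hdW eW dV' hdV')) hT₀d
    (hermD_eq_map_gramD L e' dV hdV (tensorFrame L dW eW dV') (tensorFrame_real L dW hdW eW dV' hdV')) χ hχ _ _
    (isSiegelDelta_tensorEmbLoc L e dV hdV dW hdW eW e' dV' hdV' v hk) B hB]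
  ring

end Tensor

end Summit.HodgeConjecture.HodgeConjecture.Cruxes.HLiu418.K2LiuTensorMiddleCellLeviRow

end
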